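import Summits.Ventures.LatticeQCDFlow.Exactness.Phi4LocalMetropolisReversible
import HarnessLib

/-!
# Symmetric convolution squares are positive-definite step laws; the Gaussian `N(0, 2v) = N(0, v) ⋆ N(0, v)`

HONEST FRAMING: exact (Metropolis-corrected) sampling algorithms for lattice gauge theory;
figures of merit are autocorrelation/cost numbers at stated couplings and volumes; no
continuum-physics claim.  (SCALAR calibration rung S0-A: not a gauge result.)

Venture `LatticeQCDFlow` (cell pub-lqcd), topic `Exactness`; FANOUT row 2 (`s0-phi4`, LOCAL arm).
NEW WORK of the cell over Mathlib (`gaussianPDFReal`, `integral_gaussian`, Fubini).  Nothing is cited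
as a fact.  Printed counterparts NAMED ONLY: Bochner's theorem (a step law is positive definite iff
its Fourier transform is a nonnegative measure — NOT used: the convolution-square route below is
elementary); Rudolf–Ullrich 2013 §3.4 (positive proposals).  This file supplies the hypothesis of
`Exactness/MetropolisLinePositive.lean` (`metropolis_line_positive`: random-walk Metropolis with a
positive-definite step law is a positive operator): the integrated positive-definiteness
`0 ≤ ∫∫ G(t) G(t') ρ(t' − t)` for every measurable integrable `G`.

## What is proved

* **`integral_integral_mul_convSq_nonneg`** — if `ρ(t' − t) = ∫ η(t − s) η(t' − s) ds` for a
  bounded integrable `η ≥ 0` (a symmetric convolution square), then for every measurable integrable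
  `G`:  `∫∫ G(t) G(t') ρ(t' − t) dt' dt = ∫ (∫ G(t) η(t − s) dt)² ds ≥ 0` (triple Fubini);
* `gaussianPDFReal_mul_gaussianPDFReal` (completing the square) and
  **`integral_gaussianPDFReal_mul_gaussianPDFReal`** — `∫ N(0,v)(t − s) N(0,v)(t' − s) ds
  = N(0, 2v)(t' − t)` (`v ≠ 0`);
* **`gaussian_posDef`** — the centred Gaussian step law of ANY variance `V ≠ 0` is positive
  definite in the integrated sense: `0 ≤ ∫∫ G(t) G(t') N(0,V)(t' − t)`.

NOT CLAIMED: the converse (Bochner); positive definiteness of the uniform window (false).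
-/

namespace Summit.Ventures.LatticeQCDFlow.Exactness

open Real MeasureTheory Filter Set ProbabilityTheory
open scoped NNReal

section ConvolutionSquare

/-- **SYMMETRIC CONVOLUTION SQUARES ARE POSITIVE DEFINITE (integrated form).**  If
`ρ(t' − t) = ∫ η(t − s) η(t' − s) ds` with `0 ≤ η ≤ C` measurable and integrable, then for every
measurable integrable `G` (no bound on `G` is needed: `η` is bounded):
`∫∫ G(t) G(t') ρ(t' − t) dt' dt = ∫ (∫ G(t) η(t − s) dt)² ds ≥ 0`. -/
theorem integral_integral_mul_convSq_nonneg {ρ η G : ℝ → ℝ} (hη0 : ∀ s, 0 ≤ η s)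
    (hηm : Measurable η) (hηi : Integrable η) {C : ℝ} (hηb : ∀ s, η s ≤ C)
    (hρ : ∀ t t', ρ (t' - t) = ∫ s, η (t - s) * η (t' - s))
    (hGm : Measurable G) (hGi : Integrable G) :
    ∫ t, ∫ t', G t * G t' * ρ (t' - t) = ∫ s, (∫ t, G t * η (t - s)) ^ 2 ∧
    0 ≤ ∫ t, ∫ t', G t * G t' * ρ (t' - t) := by
  have hC : 0 ≤ C := (hη0 0).trans (hηb 0)
  -- the integrand on `(ℝ × ℝ) × ℝ`
  set F : (ℝ × ℝ) × ℝ → ℝ := fun z => G z.1.1 * η (z.1.1 - z.2) * (G z.1.2 * η (z.1.2 - z.2))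
    with hF
  have hFm : Measurable F :=
    ((hGm.comp (measurable_fst.comp measurable_fst)).mul
      (hηm.comp ((measurable_fst.comp measurable_fst).sub measurable_snd))).mul
      ((hGm.comp (measurable_snd.comp measurable_fst)).mul
        (hηm.comp ((measurable_snd.comp measurable_fst).sub measurable_snd)))
  have hnormF : ∀ (p : ℝ × ℝ) (s : ℝ), ‖F (p, s)‖ = |G p.1| * |G p.2| * (η (p.1 - s) * η (p.2 - s)) := by
    intro p s
    simp only [hF, Real.norm_eq_abs, abs_mul, abs_of_nonneg (hη0 _)]
    ring
  -- sections in `s` are integrable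
  have hsec : ∀ p : ℝ × ℝ, Integrable (fun s => F (p, s)) := by
    intro p
    refine Integrable.mono' ((hηi.comp_sub_left p.1).const_mul (|G p.1| * |G p.2| * C))
      (hFm.comp (measurable_const.prodMk measurable_id)).aestronglyMeasurable
      (Eventually.of_forall fun s => ?_)
    rw [hnormF]
    have h1 : η (p.1 - s) * η (p.2 - s) ≤ C * η (p.1 - s) := by
      rw [mul_comm]
      exact mul_le_mul_of_nonneg_right (hηb _) (hη0 _)
    calc |G p.1| * |G p.2| * (η (p.1 - s) * η (p.2 - s))
        ≤ |G p.1| * |G p.2| * (C * η (p.1 - s)) :=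
          mul_le_mul_of_nonneg_left h1 (mul_nonneg (abs_nonneg _) (abs_nonneg _))
      _ = |G p.1| * |G p.2| * C * η (p.1 - s) := by ring
  -- integrability on the triple product
  have hFint : Integrable F (((volume : Measure ℝ).prod volume).prod volume) := by
    rw [integrable_prod_iff hFm.aestronglyMeasurable]
    refine ⟨Eventually.of_forall hsec, ?_⟩
    have hdom : Integrable (fun p : ℝ × ℝ => |G p.1| * |G p.2| * (C * ∫ s, η s))
        ((volume : Measure ℝ).prod volume) := (hGi.norm.mul_prod hGi.norm).mul_const _
    refine Integrable.mono' hdom hFm.aestronglyMeasurable.norm.integral_prod_right'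
      (Eventually.of_forall fun p => ?_)
    rw [Real.norm_eq_abs, abs_of_nonneg (integral_nonneg fun s => norm_nonneg _)]
    calc ∫ s, ‖F (p, s)‖ ≤ ∫ s, |G p.1| * |G p.2| * C * η (p.1 - s) := by
          refine integral_mono (hsec p).norm ((hηi.comp_sub_left p.1).const_mul _) fun s => ?_
          dsimp only
          rw [hnormF]
          have h1 : η (p.1 - s) * η (p.2 - s) ≤ C * η (p.1 - s) := by
            rw [mul_comm]
            exact mul_le_mul_of_nonneg_right (hηb _) (hη0 _)
          calc |G p.1| * |G p.2| * (η (p.1 - s) * η (p.2 - s))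
              ≤ |G p.1| * |G p.2| * (C * η (p.1 - s)) :=
                mul_le_mul_of_nonneg_left h1 (mul_nonneg (abs_nonneg _) (abs_nonneg _))
            _ = |G p.1| * |G p.2| * C * η (p.1 - s) := by ring
      _ = |G p.1| * |G p.2| * (C * ∫ s, η s) := by
          rw [integral_const_mul, integral_sub_left_eq_self η volume p.1]
          ring
  -- pointwise: the `s`-integral of `F` is the `ρ`-term
  have hF_eq : ∀ t t', ∫ s, F ((t, t'), s) = G t * G t' * ρ (t' - t) := by
    intro t t'
    rw [hρ t t', ← integral_const_mul]
    refine integral_congr_ae (Eventually.of_forall fun s => ?_)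
    simp only [hF]
    ring
  have hlhs : (fun t => ∫ t', G t * G t' * ρ (t' - t)) = fun t => ∫ t', ∫ s, F ((t, t'), s) :=
    funext fun t => integral_congr_ae (Eventually.of_forall fun t' => (hF_eq t t').symm)
  have key : ∫ t, ∫ t', G t * G t' * ρ (t' - t) = ∫ s, (∫ t, G t * η (t - s)) ^ 2 := by
    calc ∫ t, ∫ t', G t * G t' * ρ (t' - t)
        = ∫ t, ∫ t', ∫ s, F ((t, t'), s) := by rw [hlhs]
      _ = ∫ p, (∫ s, F (p, s)) ∂((volume : Measure ℝ).prod volume) :=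
          (integral_prod (fun p : ℝ × ℝ => ∫ s, F (p, s)) hFint.integral_prod_left).symm
      _ = ∫ s, (∫ p, F (p, s) ∂((volume : Measure ℝ).prod volume)) :=
          integral_integral_swap (f := fun (p : ℝ × ℝ) (s : ℝ) => F (p, s)) hFint
      _ = ∫ s, (∫ t, G t * η (t - s)) ^ 2 := by
          refine integral_congr_ae (Eventually.of_forall fun s => ?_)
          dsimp only
          rw [sq]
          exact integral_prod_mul (μ := (volume : Measure ℝ)) (ν := (volume : Measure ℝ))
            (fun t => G t * η (t - s)) (fun t => G t * η (t - s))
  exact ⟨key, key ▸ integral_nonneg fun s => sq_nonneg _⟩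

end ConvolutionSquare

/-! ## §2 The Gaussian step law is a convolution square -/

section Gaussian

/-- Completing the square: `N(0,v)(t − s) · N(0,v)(t' − s)
= (2πv)⁻¹ · exp(−(t' − t)²/(4v)) · exp(−(s − (t + t')/2)²/v)`. -/
theorem gaussianPDFReal_mul_gaussianPDFReal {v : ℝ≥0} (hv : v ≠ 0) (t t' s : ℝ) :
    gaussianPDFReal 0 v (t - s) * gaussianPDFReal 0 v (t' - s)
      = (2 * π * (v : ℝ))⁻¹ * rexp (-(t' - t) ^ 2 / (4 * (v : ℝ)))
        * rexp (-(1 / (v : ℝ)) * (s - (t + t') / 2) ^ 2) := by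
  have hv' : (0 : ℝ) < (v : ℝ) := by exact_mod_cast pos_iff_ne_zero.2 hv
  have hsq : (√(2 * π * (v : ℝ)))⁻¹ * (√(2 * π * (v : ℝ)))⁻¹ = (2 * π * (v : ℝ))⁻¹ := by
    rw [← mul_inv, Real.mul_self_sqrt (by positivity)]
  calc gaussianPDFReal 0 v (t - s) * gaussianPDFReal 0 v (t' - s)
      = (√(2 * π * (v : ℝ)))⁻¹ * (√(2 * π * (v : ℝ)))⁻¹
        * (rexp (-(t - s - 0) ^ 2 / (2 * (v : ℝ))) * rexp (-(t' - s - 0) ^ 2 / (2 * (v : ℝ)))) := by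
        simp only [gaussianPDFReal]
        ring
    _ = (2 * π * (v : ℝ))⁻¹
        * rexp (-(t - s - 0) ^ 2 / (2 * (v : ℝ)) + -(t' - s - 0) ^ 2 / (2 * (v : ℝ))) := by
        rw [hsq, Real.exp_add]
    _ = (2 * π * (v : ℝ))⁻¹
        * rexp (-(t' - t) ^ 2 / (4 * (v : ℝ)) + -(1 / (v : ℝ)) * (s - (t + t') / 2) ^ 2) := by
        congr 2
        field_simp
        ring
    _ = (2 * π * (v : ℝ))⁻¹ * rexp (-(t' - t) ^ 2 / (4 * (v : ℝ)))
        * rexp (-(1 / (v : ℝ)) * (s - (t + t') / 2) ^ 2) := by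
        rw [Real.exp_add]
        ring

/-- **`N(0, v) ⋆ N(0, v) = N(0, 2v)`** as densities:
`∫ N(0,v)(t − s) N(0,v)(t' − s) ds = N(0, 2v)(t' − t)` for `v ≠ 0`. -/
theorem integral_gaussianPDFReal_mul_gaussianPDFReal {v : ℝ≥0} (hv : v ≠ 0) (t t' : ℝ) :
    ∫ s, gaussianPDFReal 0 v (t - s) * gaussianPDFReal 0 v (t' - s)
      = gaussianPDFReal 0 (2 * v) (t' - t) := by
  have hv' : (0 : ℝ) < (v : ℝ) := by exact_mod_cast pos_iff_ne_zero.2 hv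
  simp_rw [gaussianPDFReal_mul_gaussianPDFReal hv t t']
  rw [integral_const_mul,
    integral_sub_right_eq_self (fun s => rexp (-(1 / (v : ℝ)) * s ^ 2)) ((t + t') / 2),
    integral_gaussian (1 / (v : ℝ))]
  -- `√(π/(1/v)) = √(πv)`, `√(2π·2v) = 2√(πv)`
  have e1 : π / (1 / (v : ℝ)) = π * (v : ℝ) := by field_simp
  rw [e1]
  set r := √(π * (v : ℝ)) with hr
  have hr0 : 0 < r := Real.sqrt_pos.2 (by positivity)
  have hr2 : r ^ 2 = π * (v : ℝ) := Real.sq_sqrt (by positivity)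
  have h2v : ((2 * v : ℝ≥0) : ℝ) = 2 * (v : ℝ) := by push_cast; ring
  have hs2 : √(2 * π * (2 * (v : ℝ))) = 2 * r := by
    have e : 2 * π * (2 * (v : ℝ)) = (2 : ℝ) ^ 2 * (π * (v : ℝ)) := by ring
    rw [e, Real.sqrt_mul (by norm_num : (0 : ℝ) ≤ 2 ^ 2), Real.sqrt_sq (by norm_num : (0 : ℝ) ≤ 2),
      hr]
  simp only [gaussianPDFReal, sub_zero, h2v, hs2]
  rw [show (2 : ℝ) * (2 * (v : ℝ)) = 4 * (v : ℝ) by ring]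
  have hπv : 2 * π * (v : ℝ) = 2 * r ^ 2 := by rw [hr2]; ring
  have hr1 : r ≠ 0 := hr0.ne'
  rw [hπv]
  field_simp

/-- **THE CENTRED GAUSSIAN STEP LAW IS POSITIVE DEFINITE (integrated form).**  For every variance
`V ≠ 0` and every measurable integrable `G`:
`0 ≤ ∫∫ G(t) G(t') N(0,V)(t' − t) dt' dt` (it is `∫ (G ⋆ N(0,V/2))² ≥ 0`). -/
theorem gaussian_posDef {V : ℝ≥0} (hV : V ≠ 0) {G : ℝ → ℝ} (hGm : Measurable G)
    (hGi : Integrable G) :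
    0 ≤ ∫ t, ∫ t', G t * G t' * gaussianPDFReal 0 V (t' - t) := by
  have hv : V / 2 ≠ 0 := by
    intro h
    exact hV (by simpa using h)
  have hv' : (0 : ℝ) < ((V / 2 : ℝ≥0) : ℝ) := by exact_mod_cast pos_iff_ne_zero.2 hv
  have h2 : 2 * (V / 2) = V := mul_div_cancel₀ V two_ne_zero
  -- `η = N(0, V/2)` is bounded by its value at `0`
  have hηb : ∀ s, gaussianPDFReal 0 (V / 2) s ≤ (√(2 * π * ((V / 2 : ℝ≥0) : ℝ)))⁻¹ := by
    intro s
    unfold gaussianPDFReal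
    have h1 : rexp (-(s - 0) ^ 2 / (2 * ((V / 2 : ℝ≥0) : ℝ))) ≤ 1 := by
      rw [Real.exp_le_one_iff]
      exact div_nonpos_of_nonpos_of_nonneg (neg_nonpos.2 (sq_nonneg _)) (by positivity)
    calc (√(2 * π * ((V / 2 : ℝ≥0) : ℝ)))⁻¹ * rexp (-(s - 0) ^ 2 / (2 * ((V / 2 : ℝ≥0) : ℝ)))
        ≤ (√(2 * π * ((V / 2 : ℝ≥0) : ℝ)))⁻¹ * 1 :=
          mul_le_mul_of_nonneg_left h1 (inv_nonneg.2 (Real.sqrt_nonneg _))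
      _ = _ := mul_one _
  have hρ : ∀ t t', gaussianPDFReal 0 V (t' - t)
      = ∫ s, gaussianPDFReal 0 (V / 2) (t - s) * gaussianPDFReal 0 (V / 2) (t' - s) := by
    intro t t'
    rw [integral_gaussianPDFReal_mul_gaussianPDFReal hv, h2]
  exact (integral_integral_mul_convSq_nonneg (ρ := gaussianPDFReal 0 V)
    (fun s => gaussianPDFReal_nonneg 0 (V / 2) s) (measurable_gaussianPDFReal 0 (V / 2))
    (integrable_gaussianPDFReal 0 (V / 2)) hηb hρ hGm hGi).2

end Gaussian

end Summit.Ventures.LatticeQCDFlow.Exactness
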